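import Literature.Computability.AlgebraicComplexity.MS21IndependentMapLemmas
import Mathlib.RingTheory.MvPolynomial.Expand
import Mathlib.Algebra.MvPolynomial.Division
import Mathlib.Algebra.MvPolynomial.NoZeroDivisors
import HarnessLib

/-!
# Medini–Shpilka 2021, Thm 43: `(t+1)`-independent maps hit the affine orbits of `2^t`-sparse
# polynomials (`MS2021_thm_43_holds`)

Theorem-only companion of `MS21DenseOrbitsHittingSets.lean` (cell `val-lit`, seat p1 g5): a PROOF
of the typed fact `MS2021_thm_43` — "Let `0 ≠ g ∈ F[x]` have sparsity `≤ 2^t`. Let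
`(A, b) ∈ GLaff_n(F)`, and `f(x) = g(Ax + b)`. Then, for any `(t+1)`-independent polynomial map `G`,
`f ∘ G ≠ 0`" — over EVERY field, following the printed proof [MediniShpilka2021, §6.1 = arXiv
p0034:L31–p0035:L3] over the §3 toolkit of `MS21IndependentMapLemmas.lean` (seat t24 g5: peeling
`isIndependent_succ_iff`, Obs 3.1 `IsIndependent.bind₁_affine_ne_zero`, Lemma 3.8/3.9
`exists_dirDeriv_mem_affOrbit_pderiv` + `bind₁_peel_ne_zero_of_dirDeriv`, Lemma 3.10
`exists_shift_mem_affOrbit` + `bind₁_peel_ne_zero_of_shift`). This file supplies §6.1 proper: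

* the sparsity bookkeeping of the four operations on `g` — the projection `g̃ = g|_{y_i = 0}`
  (`MS2021.aeval_restrictZero_eq`, `MS2021.card_support_restrictZero`), the derivative `∂g/∂y_i`
  (`MS2021.card_support_pderiv_le`, `MS2021.pderiv_ne_zero_of_cast_ne_zero`), division by `y_i`
  (`MS2021.X_mul_divMonomial_eq_self`, `MS2021.card_support_divMonomial_le`) and, in characteristic
  `p`, the Frobenius contraction (`MS2021.expand_contract_eq_self`, `MS2021.card_support_contract_le`);
* the induction of §6.1 (`MS2021.bind₁_affSubst_ne_zero_of_card_support_le`): outer induction on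
  `t`, inner induction on `deg g` for the step "WLOG no `x_i` divides `g`" (peel one factor
  `ℓ_i + b_i`, nonzero on `G` by Obs 3.1; `F[y, z]` is a domain); Case 2 = projection when a variable
  of `g` lies in `≥ 2^{t-1}` monomials; Case 1 = derivative along the dual vector when it lies in
  `< 2^{t-1}` monomials.

SUPPLEMENT FOR POSITIVE CHARACTERISTIC (ours, disclosed): the fact is typed, as printed, for
"arbitrary `F`", but the printed Case 1 asserts "`∂g/∂x_i` is non-zero" for `x_i ∈ var(g)`, which
fails in characteristic `p` when every exponent of `x_i` in `g` is divisible by `p` (e.g.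
`g = y_1^p y_3 y_4 + y_2^p y_3 y_5 + y_3 y_4 y_5 + y_4 y_5^2`, `t = 2`: no variable lies in `≥ 2`
monomials except `y_3, y_4, y_5`, … — the case split must be made with care). Here Case 1 is
entered only with a variable having SOME exponent nonzero in `F` (then `∂g/∂x_i ≠ 0`,
`MS2021.pderiv_ne_zero_of_cast_ne_zero`), Case 2 with any variable in `≥ 2^{t-1}` monomials, and if
EVERY exponent of EVERY monomial of `g` vanishes in `F`, then `char F = p > 0` divides them all,
`g(y) = G̃(y_1^p, …, y_m^p)` with `G̃` of the same sparsity and smaller degree, and by the freshman's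
dream `g(Ax + b) ∘ G = (G̃(A^{(p)} x + b^{(p)}) ∘ G^{(p)})(y^p, z^p)` where `(·)^{(p)}` raises
coefficients to the `p`-th power — `A^{(p)}` is still invertible and `G^{(p)}` still
`(t+1)`-independent (`MS2021.affSubst_expand_eq`, `MS2021.IsIndependent.map_ringHom`) — so the inner
induction on the degree applies and `expand p` is injective. The statement proved is exactly the
typed one; only the proof is supplemented.

No new definitions, no new facts (D-0026): net debt `−1`. HONEST FRAMING: a known 2021 result
(hitting-set generators for orbits of sparse polynomials) is now a theorem of the tree; typed ≠
endorsed; `VP ≠ VNP` is NOT proved and this is no progress on it.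

## References
* [MediniShpilka2021] D. Medini, A. Shpilka, CCC 2021 (LIPIcs 200:19) Thm 43 (p.19:14; = arXiv
  ‹PITSINV› p0009:L1-L2) and its proof §6.1 (arXiv:2102.05632 held text p0034:L31-p0035:L3); §3
  Obs 3.1, Lemmas 3.8–3.10 (p0017–p0018) via `MS21IndependentMapLemmas.lean`.
-/

noncomputable section

open MvPolynomial Matrix

namespace Literature.Computability.AlgebraicComplexity

namespace MS2021

/-! ### The four operations on the sparse polynomial `g`: restriction `y_i := 0`, derivative
`∂/∂y_i`, division by `y_i`, and (characteristic `p`) the Frobenius contraction -/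

section Sparse

variable {K : Type*} [Field K] {σ : Type*} [DecidableEq σ]

/-- Coefficients of a sum of monomials over a finite set of exponents. [folklore] -/
private theorem coeff_sum_monomial (S : Finset (σ →₀ ℕ)) (c : (σ →₀ ℕ) → K) (β : σ →₀ ℕ) :
    coeff β (∑ α ∈ S, monomial α (c α)) = if β ∈ S then c β else 0 := by
  rw [coeff_sum]
  simp_rw [coeff_monomial]
  rw [Finset.sum_ite_eq']

/-- The support of `∑_{α ∈ S} c_α y^α` for `S ⊆ supp g`, `c_α` the coefficients of `g`, is `S`. [folklore] -/
private theorem support_sum_monomial_coeff_eq (g : MvPolynomial σ K) {S : Finset (σ →₀ ℕ)}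
    (hS : S ⊆ g.support) : (∑ α ∈ S, monomial α (coeff α g)).support = S := by
  ext β
  rw [mem_support_iff, coeff_sum_monomial]
  constructor
  · intro h
    by_contra hβ
    exact h (if_neg hβ)
  · intro hβ
    rw [if_pos hβ]
    exact mem_support_iff.1 (hS hβ)

/-- **The projection `g̃ = g|_{y_i = 0}`** (Case 2 of the proof of Thm 43: "define
`g̃(x) ≜ g(0, x_2, x_3, …, x_n)`"): substituting into `g̃ = ∑_{α : α_i = 0} c_α y^α` is substituting
into `g` with `y_i := 0`. [cite: MediniShpilka2021, proof of Thm 43, Case 2 (arXiv p0035:L1)] -/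
theorem aeval_restrictZero_eq {A : Type*} [CommRing A] [Algebra K A] (g : MvPolynomial σ K) (i : σ)
    (θ : σ → A) :
    aeval θ (∑ α ∈ g.support with α i = 0, monomial α (coeff α g)) =
      aeval (Function.update θ i 0) g := by
  conv_rhs => rw [g.as_sum]
  rw [map_sum, map_sum, Finset.sum_filter]
  refine Finset.sum_congr rfl fun α _ => ?_
  split_ifs with h
  · rw [aeval_monomial, aeval_monomial, Finsupp.prod, Finsupp.prod]
    congr 1
    refine Finset.prod_congr rfl fun r hr => ?_
    have hri : r ≠ i := by
      rintro rfl
      exact (Finsupp.mem_support_iff.1 hr) h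
    simp only [Function.update_of_ne hri]
  · rw [aeval_monomial, Finsupp.prod, Finset.prod_eq_zero (Finsupp.mem_support_iff.2 h)
      (by rw [Function.update_self, zero_pow h]), mul_zero]

/-- Sparsity of the projection: `#supp g̃ = #supp g - #{monomials containing y_i}`.
[cite: MediniShpilka2021, proof of Thm 43, Case 2 ("is of sparsity `≤ 2^{t-1}`", arXiv p0035:L1)] -/
theorem card_support_restrictZero (g : MvPolynomial σ K) (i : σ) :
    (∑ α ∈ g.support with α i = 0, monomial α (coeff α g)).support.card +
      (g.support.filter fun α => α i ≠ 0).card = g.support.card := by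
  rw [support_sum_monomial_coeff_eq g (Finset.filter_subset _ _)]
  exact Finset.card_filter_add_card_filter_not _

/-- **The derivative `∂g/∂y_i`** has support inside `{α - e_i : α ∈ supp g, α_i ≠ 0}` ("by choice of
`x_i`, `∂g/∂x_i` is … of sparsity `≤ 2^{t-1}`"). [cite: MediniShpilka2021, proof of Thm 43, Case 1 (arXiv p0034:L49)] -/
theorem support_pderiv_subset (g : MvPolynomial σ K) (i : σ) :
    (pderiv i g).support ⊆
      (g.support.filter fun α => α i ≠ 0).image fun α => α - Finsupp.single i 1 := by
  intro β hβ
  rw [mem_support_iff, coeff_pderiv] at hβ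
  have h1 : coeff (β + Finsupp.single i 1) g ≠ 0 := fun h => hβ (by rw [h, zero_mul])
  refine Finset.mem_image.2 ⟨β + Finsupp.single i 1, Finset.mem_filter.2 ⟨mem_support_iff.2 h1, ?_⟩, ?_⟩
  · simp
  · exact add_tsub_cancel_right _ _

/-- Sparsity of the derivative: `#supp (∂g/∂y_i) ≤ #{monomials of g containing y_i}`.
[cite: MediniShpilka2021, proof of Thm 43, Case 1 (arXiv p0034:L49)] -/
theorem card_support_pderiv_le (g : MvPolynomial σ K) (i : σ) :
    (pderiv i g).support.card ≤ (g.support.filter fun α => α i ≠ 0).card :=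
  (Finset.card_le_card (support_pderiv_subset g i)).trans Finset.card_image_le

omit [DecidableEq σ] in
/-- **Nonvanishing of the derivative** (all characteristics): if some monomial of `g` has a
`y_i`-exponent that is nonzero IN THE FIELD, then `∂g/∂y_i ≠ 0`. (The printed "`∂g/∂x_i` is non-zero"
for `x_i ∈ var(g)` is the characteristic-`0` case; in characteristic `p` the exponent must not be a
multiple of `p`.) [cite: MediniShpilka2021, proof of Thm 43, Case 1 (arXiv p0034:L49)] -/
theorem pderiv_ne_zero_of_cast_ne_zero (g : MvPolynomial σ K) (i : σ) {α : σ →₀ ℕ}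
    (hα : α ∈ g.support) (hαi : (α i : K) ≠ 0) : pderiv i g ≠ 0 := by
  have hαi' : 1 ≤ α i := by
    rcases Nat.eq_zero_or_pos (α i) with h | h
    · rw [h, Nat.cast_zero] at hαi; exact absurd rfl hαi
    · exact h
  have hle : Finsupp.single i 1 ≤ α := Finsupp.single_le_iff.2 hαi'
  intro h0
  have h1 := congr_arg (coeff (α - Finsupp.single i 1)) h0
  rw [coeff_pderiv, coeff_zero, tsub_add_cancel_of_le hle] at h1
  have hcast : (((α - Finsupp.single i 1 : σ →₀ ℕ) i : ℕ) : K) + 1 = (α i : K) := by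
    rw [Finsupp.tsub_apply, Finsupp.single_eq_same, ← Nat.cast_succ, Nat.succ_eq_add_one,
      Nat.sub_add_cancel hαi']
  rw [hcast] at h1
  exact mul_ne_zero (mem_support_iff.1 hα) hαi h1

omit [DecidableEq σ] in
/-- **Division by `y_i`** when every monomial of `g` contains `y_i` ("we can take some `g̃` such that
`g = x_i^k g̃` … and both have the same sparsity" — here one power at a time).
[cite: MediniShpilka2021, proof of Thm 43 (arXiv p0034:L45)] -/
theorem X_mul_divMonomial_eq_self (g : MvPolynomial σ K) (i : σ)
    (h : ∀ α ∈ g.support, α i ≠ 0) :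
    X i * g.divMonomial (Finsupp.single i 1) = g := by
  conv_rhs => rw [← g.divMonomial_add_modMonomial_single i]
  suffices hmod : g.modMonomial (Finsupp.single i 1) = 0 by rw [hmod, add_zero]
  ext β
  rw [coeff_zero]
  by_cases hβ : Finsupp.single i 1 ≤ β
  · exact coeff_modMonomial_of_le g hβ
  · rw [coeff_modMonomial_of_not_le g hβ]
    by_contra hne
    refine hβ (Finsupp.single_le_iff.2 ?_)
    exact Nat.one_le_iff_ne_zero.2 (h β (mem_support_iff.2 hne))

/-- Sparsity is not increased by division by `y_i`. [cite: MediniShpilka2021, proof of Thm 43 (arXiv p0034:L45)] -/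
theorem card_support_divMonomial_le (g : MvPolynomial σ K) (i : σ) :
    (g.divMonomial (Finsupp.single i 1)).support.card ≤ g.support.card := by
  have hsub : (g.divMonomial (Finsupp.single i 1)).support ⊆
      g.support.image fun α => α - Finsupp.single i 1 := by
    intro β hβ
    rw [mem_support_iff, coeff_divMonomial] at hβ
    exact Finset.mem_image.2 ⟨_, mem_support_iff.2 hβ, add_tsub_cancel_left _ _⟩
  exact (Finset.card_le_card hsub).trans Finset.card_image_le

omit [DecidableEq σ] in
/-- **Frobenius contraction** (our characteristic-`p` supplement to the printed proof): if every
exponent of every monomial of `g` is divisible by `p`, then `g(y) = G̃(y_1^p, …, y_m^p)` for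
`G̃ = ∑ c_α y^{α/p}`, of no larger sparsity. [cite: MediniShpilka2021, Thm 43 ("arbitrary `F`"; arXiv p0009:L1-L2)] -/
theorem expand_contract_eq_self (g : MvPolynomial σ K) {p : ℕ}
    (h : ∀ α ∈ g.support, ∀ r, p ∣ α r) :
    expand p (∑ α ∈ g.support,
        monomial (Finsupp.mapRange (fun e => e / p) (Nat.zero_div p) α) (coeff α g)) = g := by
  rw [map_sum]
  conv_rhs => rw [g.as_sum]
  refine Finset.sum_congr rfl fun α hα => ?_
  rw [expand_monomial]
  have hexp : p • Finsupp.mapRange (fun e => e / p) (Nat.zero_div p) α = α := by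
    ext r
    rw [Finsupp.smul_apply, Finsupp.mapRange_apply, smul_eq_mul, Nat.mul_div_cancel' (h α hα r)]
  rw [hexp]

/-- Sparsity of the Frobenius contraction. [cite: MediniShpilka2021, Thm 43 (arXiv p0009:L1-L2)] -/
theorem card_support_contract_le (g : MvPolynomial σ K) (p : ℕ) :
    (∑ α ∈ g.support,
        monomial (Finsupp.mapRange (fun e => e / p) (Nat.zero_div p) α) (coeff α g)).support.card ≤
      g.support.card := by
  have hsub : (∑ α ∈ g.support,
      monomial (Finsupp.mapRange (fun e => e / p) (Nat.zero_div p) α) (coeff α g)).support ⊆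
      g.support.image fun α => Finsupp.mapRange (fun e => e / p) (Nat.zero_div p) α := by
    intro β hβ
    obtain ⟨α, hα, hβα⟩ := Finset.mem_biUnion.1 (MvPolynomial.support_sum hβ)
    exact Finset.mem_image.2 ⟨α, hα, (Finset.mem_singleton.1 (support_monomial_subset hβα)).symm⟩
  exact (Finset.card_le_card hsub).trans Finset.card_image_le

end Sparse

/-! ### Characteristic `p`: the Frobenius twist (our supplement for "arbitrary `F`") -/

section Frobenius

variable {K : Type*} [Field K] (p : ℕ) [ExpChar K p]

/-- `q^p = (q^{(p)})(x^p)` where `q^{(p)}` has the coefficients of `q` raised to the `p`-th power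
(freshman's dream, Mathlib's `map_frobenius_expand`). [folklore] -/
private theorem pow_expChar_eq_expand_map_frobenius {τ : Type*} (q : MvPolynomial τ K) :
    q ^ p = expand p (map (frobenius K p) q) := by
  rw [← map_expand, map_frobenius_expand]

variable {n c : ℕ}

/-- `1`-independence is preserved by twisting the coefficients with a ring endomorphism (the
assignment `a_i` of Def 19 is twisted along). [cite: MediniShpilka2021, Def 19 (arXiv p0006:L64-L65)] -/
theorem IsOneIndependent.map_ringHom {G₁ : Fin n → MvPolynomial (Fin c ⊕ Unit) K}
    (hG : IsOneIndependent G₁) (φ : K →+* K) : IsOneIndependent fun j => map φ (G₁ j) := by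
  intro i
  obtain ⟨a, ha⟩ := hG i
  refine ⟨fun s => φ (a s), fun j => ?_⟩
  have h1 := congr_arg (map φ) (ha j)
  rw [aeval_eq_bind₁, map_bind₁] at h1
  rw [aeval_eq_bind₁]
  have hfun : (fun s : Fin c ⊕ Unit => map φ
      ((Sum.elim (fun s => C (a s)) (fun _ => X ()) : Fin c ⊕ Unit → MvPolynomial Unit K) s)) =
      (Sum.elim (fun s => C (φ (a s))) (fun _ => X ()) : Fin c ⊕ Unit → MvPolynomial Unit K) := by
    funext s
    rcases s with s | u
    · simp [map_C]
    · simp [map_X]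
  rw [hfun] at h1
  rw [h1]
  split_ifs
  · rw [map_X]
  · rw [map_zero]

variable {k : ℕ}

/-- `k`-independence is preserved by twisting the coefficients with a ring endomorphism.
[cite: MediniShpilka2021, Def 19 (arXiv p0006:L65)] -/
theorem IsIndependent.map_ringHom {G : Fin n → MvPolynomial (Fin k × (Fin c ⊕ Unit)) K}
    (hG : IsIndependent k G) (φ : K →+* K) : IsIndependent k fun j => map φ (G j) := by
  obtain ⟨Gs, hGs, hsum⟩ := hG
  refine ⟨fun l j => map φ (Gs l j), fun l => (hGs l).map_ringHom φ, fun j => ?_⟩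
  simp only [hsum j, map_sum, map_rename]

/-- Composition with `G` of a polynomial in `x^p`: `F(x^p) ∘ G = (F ∘ G^{(p)})(y^p, z^p)`.
[folklore] -/
private theorem bind₁_expand_eq_expand_bind₁_map_frobenius {τ : Type*} (G : Fin n → MvPolynomial τ K)
    (F : MvPolynomial (Fin n) K) :
    bind₁ G (expand p F) = expand p (bind₁ (fun j => map (frobenius K p) (G j)) F) := by
  rw [← aeval_eq_bind₁, ← aeval_eq_bind₁, aeval_expand]
  have hfun : (G ^ p) = fun j => expand p (map (frobenius K p) (G j)) := by
    funext j
    rw [Pi.pow_apply, pow_expChar_eq_expand_map_frobenius]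
  rw [hfun, ← comp_aeval, AlgHom.comp_apply]

variable {m : ℕ}

/-- The Frobenius twist of an affine substitution: `(∑_j A_{rj} x_j + b_r)^p = ∑_j A_{rj}^p x_j^p + b_r^p`,
so `G̃(x^p)(Ax + b) = (G̃(A^{(p)} x + b^{(p)}))(x^p)` (for the substitution `f(Ax + b)` of eq. (2)).
[cite: MediniShpilka2021, §1.1.6 eq. (2) (CCC p.19:9; arXiv p0007:L7-L10)] -/
theorem affSubst_expand_eq (h : m ≤ n) (A : Matrix (Fin n) (Fin n) K) (b : Fin n → K)
    (F : MvPolynomial (Fin m) K) :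
    affSubst h A b (expand p F) =
      expand p (affSubst h (A.map (frobenius K p)) (fun r => frobenius K p (b r)) F) := by
  unfold affSubst
  rw [aeval_expand]
  have hfun : ((fun i : Fin m => (∑ j : Fin n, C (A (Fin.castLE h i) j) * X j) + C (b (Fin.castLE h i)))
      ^ p) = fun i : Fin m => expand p ((∑ j : Fin n, C ((A.map (frobenius K p)) (Fin.castLE h i) j) * X j)
        + C (frobenius K p (b (Fin.castLE h i)))) := by
    funext i
    rw [Pi.pow_apply, pow_expChar_eq_expand_map_frobenius]
    congr 1
    simp only [map_add, map_sum, map_mul, map_C, map_X, Matrix.map_apply]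
  rw [hfun, ← comp_aeval, AlgHom.comp_apply]

/-- Entrywise Frobenius keeps a matrix invertible: `det A^{(p)} = (det A)^p`. [folklore] -/
private theorem isUnit_det_map_frobenius {A : Matrix (Fin n) (Fin n) K} (hA : IsUnit A.det) :
    IsUnit (A.map (frobenius K p)).det := by
  rw [← RingHom.mapMatrix_apply, ← RingHom.map_det]
  exact hA.map _

end Frobenius

/-! ### The induction (proof of Thm 43, §6.1) -/

section Main

variable {K : Type*} [Field K] {n : ℕ}

/-- The toolkit's projection `g(y)|_{y_i := 0}` (a substitution) is the sum of the monomials of `g`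
not containing `y_i`. [cite: MediniShpilka2021, proof of Thm 43, Case 2 (arXiv p0035:L1)] -/
theorem aeval_ite_X_eq_restrictZero {m : ℕ} (g : MvPolynomial (Fin m) K) (i : Fin m) :
    aeval (fun w : Fin m => if w = i then (0 : MvPolynomial (Fin m) K) else X w) g =
      ∑ α ∈ g.support with α i = 0, monomial α (coeff α g) := by
  classical
  have key := aeval_restrictZero_eq g i (X : Fin m → MvPolynomial (Fin m) K)
  rw [aeval_X_left_apply] at key
  rw [key]
  have hfun : (fun w : Fin m => if w = i then (0 : MvPolynomial (Fin m) K) else X w) =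
      Function.update X i 0 := by
    funext w
    rw [Function.update_apply]
  rw [hfun]

/-- **Thm 43, the induction** ("By induction on `t`"), for fixed `F` and `n`, in the form: for every
`t`, every degree bound `D`, every `0 ≠ g ∈ F[y_1..y_m]` with `≤ 2^t` monomials and `deg g ≤ D`,
every `(A, b) ∈ GLaff_n(F)` and every `(t+1)`-independent `G`, `g(Ax + b) ∘ G ≠ 0`. The printed steps:
"WLOG no variable `x_i` divides `g`" (else peel one factor `ℓ_i + b_i`, nonzero on `G` by the base
case, and use that `F[y, z]` is a domain — inner induction on the degree); Case 2 (some variable of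
`g` lies in `≥ 2^{t-1}` monomials): project by Lemma 3.10; Case 1 (a variable in `< 2^{t-1}`
monomials): differentiate along the dual vector, Lemmas 3.8–3.9. SUPPLEMENT (ours) for positive
characteristic `p`, where the printed "`∂g/∂x_i` is non-zero" can fail: Case 1 is entered with a
variable having an exponent that is nonzero in `F`; if every exponent of every monomial vanishes in
`F` (all divisible by `p`), then `g(y) = G̃(y^p)` and `g(Ax+b) ∘ G = (G̃(A^{(p)}x + b^{(p)}) ∘ G^{(p)})(y^p, z^p)`
with `G̃` of the same sparsity and smaller degree (inner induction).
[cite: MediniShpilka2021, Thm 43 and its proof, §6.1 (CCC p.19:14; arXiv p0009:L1-L2, p0034:L31-L49, p0035:L1-L3)] -/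
theorem bind₁_affSubst_ne_zero_of_card_support_le :
    ∀ (t D m : ℕ) (g : MvPolynomial (Fin m) K), g ≠ 0 → g.support.card ≤ 2 ^ t →
      g.totalDegree ≤ D → ∀ (h : m ≤ n) (A : Matrix (Fin n) (Fin n) K) (b : Fin n → K),
      IsUnit A.det → ∀ (c : ℕ) (G : Fin n → MvPolynomial (Fin (t + 1) × (Fin c ⊕ Unit)) K),
      IsIndependent (t + 1) G → bind₁ G (affSubst h A b g) ≠ 0 := by
  classical
  intro t
  induction t using Nat.strong_induction_on with
  | _ t iht =>
  intro D
  induction D using Nat.strong_induction_on with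
  | _ D ihD =>
  intro m g hg hs hD h A b hA c G hG
  -- Step 0: constant `g`
  by_cases h0 : g.totalDegree = 0
  · rw [totalDegree_eq_zero_iff_eq_C] at h0
    rw [h0]
    unfold affSubst
    rw [aeval_C, algebraMap_eq, bind₁_C_right, Ne, C_eq_zero]
    intro hc
    exact hg (by rw [h0, hc, map_zero])
  -- Step R ("WLOG no variable divides g"): peel one factor `y_i`
  by_cases hR : ∃ i, ∀ α ∈ g.support, α i ≠ 0
  · obtain ⟨i, hi⟩ := hR
    have hfac : X i * g.divMonomial (Finsupp.single i 1) = g := X_mul_divMonomial_eq_self g i hi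
    have hg' : g.divMonomial (Finsupp.single i 1) ≠ 0 := fun h0' =>
      hg (by rw [← hfac, h0', mul_zero])
    have hdeg : (g.divMonomial (Finsupp.single i 1)).totalDegree < D := by
      have hmul := totalDegree_mul_of_isDomain (X_ne_zero i : (X i : MvPolynomial (Fin m) K) ≠ 0) hg'
      rw [hfac, totalDegree_X] at hmul
      omega
    have ih := ihD _ hdeg m _ hg' ((card_support_divMonomial_le g i).trans hs) le_rfl h A b hA c G hG
    rw [← hfac]
    unfold affSubst at ih ⊢
    rw [map_mul, aeval_X, map_mul]
    refine mul_ne_zero ?_ ih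
    exact hG.bind₁_affine_ne_zero (Nat.succ_pos t) _ _
      (exists_apply_ne_zero_of_isUnit_det hA (Fin.castLE h i))
  push Not at hR
  -- a variable with an exponent that is nonzero in `K`?
  by_cases hE : ∃ i, ∃ α ∈ g.support, (α i : K) ≠ 0
  · obtain ⟨i, α, hα, hαi⟩ := hE
    obtain ⟨α₀, hα₀, hα₀i⟩ := hR i
    -- then `g` has at least two monomials, so `t ≥ 1`
    have hne : α ≠ α₀ := by
      rintro rfl
      rw [hα₀i, Nat.cast_zero] at hαi
      exact hαi rfl
    have h2 : 1 < g.support.card := Finset.one_lt_card.2 ⟨α, hα, α₀, hα₀, hne⟩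
    obtain ⟨t', rfl⟩ : ∃ t', t = t' + 1 := by
      rcases t with _ | t'
      · simp at hs; omega
      · exact ⟨t', rfl⟩
    -- peel `G = G_1 + G'`
    obtain ⟨G₁, G', hG₁, hG', hGeq⟩ := isIndependent_succ_iff.mp hG
    have hGfun : G = fun j => rename (Prod.mk 0) (G₁ j) + rename (Prod.map Fin.succ id) (G' j) :=
      funext hGeq
    rw [hGfun]
    have hf : affSubst h A b g ∈ affOrbit n g := ⟨h, A, b, hA, rfl⟩
    by_cases hN : 2 ^ t' ≤ (g.support.filter fun α => α i ≠ 0).card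
    · -- Case 2 (projection): `g̃ = g|_{y_i = 0}` has `≤ 2^{t'}` monomials and is nonzero
      have hgt_ne : (∑ α ∈ g.support with α i = 0, monomial α (coeff α g)) ≠ 0 := by
        intro h0'
        have hsupp := support_sum_monomial_coeff_eq g (Finset.filter_subset (fun α => α i = 0) g.support)
        rw [h0', support_zero] at hsupp
        have : α₀ ∈ g.support.filter (fun α => α i = 0) := Finset.mem_filter.2 ⟨hα₀, hα₀i⟩
        rw [← hsupp] at this
        exact absurd this (Finset.notMem_empty _)
      have hgt_card : (∑ α ∈ g.support with α i = 0, monomial α (coeff α g)).support.card ≤ 2 ^ t' := by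
        have := card_support_restrictZero g i
        rw [pow_succ] at hs
        omega
      obtain ⟨j, L, h', A', b', hA', hfeq⟩ := exists_shift_mem_affOrbit hf i
      refine bind₁_peel_ne_zero_of_shift hG₁ G' _ j L ?_
      rw [hfeq, aeval_ite_X_eq_restrictZero]
      exact iht t' (lt_add_one t') _ m _ hgt_ne hgt_card le_rfl h' A' b' hA' c G' hG'
    · -- Case 1 (derivative along the dual vector)
      push Not at hN
      have hg' : pderiv i g ≠ 0 := pderiv_ne_zero_of_cast_ne_zero g i hα hαi
      have hs' : (pderiv i g).support.card ≤ 2 ^ t' := (card_support_pderiv_le g i).trans hN.le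
      obtain ⟨v, h', A', b', hA', hfeq⟩ := exists_dirDeriv_mem_affOrbit_pderiv hf i
      refine bind₁_peel_ne_zero_of_dirDeriv hG₁ G' _ v ?_
      rw [hfeq]
      exact iht t' (lt_add_one t') _ m _ hg' hs' le_rfl h' A' b' hA' c G' hG'
  · -- every exponent of every monomial vanishes in `K`: characteristic `p > 0`, Frobenius twist
    push Not at hE
    obtain ⟨α, hα, hα0⟩ : ∃ α ∈ g.support, α ≠ 0 := by
      by_contra hcon
      push Not at hcon
      refine h0 (Nat.eq_zero_of_le_zero (Finset.sup_le fun α hα => ?_))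
      rw [hcon α hα]
      simp
    obtain ⟨i, hi⟩ : ∃ i, α i ≠ 0 := by
      by_contra hcon
      push Not at hcon
      exact hα0 (Finsupp.ext hcon)
    have hpdvd : ∀ α ∈ g.support, ∀ r, ringChar K ∣ α r := fun α hα r =>
      (ringChar.spec K (α r)).1 (hE r α hα)
    have hp0 : ringChar K ≠ 0 := by
      intro hp0
      have := hpdvd α hα i
      rw [hp0, zero_dvd_iff] at this
      exact hi this
    have hprime : (ringChar K).Prime := CharP.char_prime_of_ne_zero K hp0
    haveI : ExpChar K (ringChar K) := ExpChar.prime hprime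
    have hexp := expand_contract_eq_self g hpdvd
    have hgt_ne : (∑ α ∈ g.support, monomial (Finsupp.mapRange (fun e => e / ringChar K)
        (Nat.zero_div _) α) (coeff α g)) ≠ 0 := by
      intro h0'
      rw [h0', map_zero] at hexp
      exact hg hexp.symm
    have hgt_deg : (∑ α ∈ g.support, monomial (Finsupp.mapRange (fun e => e / ringChar K)
        (Nat.zero_div _) α) (coeff α g)).totalDegree < D := by
      have h1 := congr_arg totalDegree hexp
      rw [totalDegree_expand] at h1
      have h2 := hprime.two_le
      have h3 := Nat.mul_le_mul_left (∑ α ∈ g.support, monomial (Finsupp.mapRange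
        (fun e => e / ringChar K) (Nat.zero_div _) α) (coeff α g)).totalDegree h2
      omega
    have ih := ihD _ hgt_deg m _ hgt_ne ((card_support_contract_le g _).trans hs) le_rfl h
      (A.map (frobenius K (ringChar K))) (fun r => frobenius K (ringChar K) (b r))
      (isUnit_det_map_frobenius _ hA) c (fun j => map (frobenius K (ringChar K)) (G j))
      (hG.map_ringHom _)
    rw [← hexp, affSubst_expand_eq, bind₁_expand_eq_expand_bind₁_map_frobenius]
    exact (expand_ne_zero hprime.pos).2 ih

end Main

end MS2021

/-! ### The theorem -/

section Thm43

open MS2021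

/-- **MS Thm 43 holds** (arXiv ‹PITSINV›): for `0 ≠ g` of sparsity `≤ 2^t`, `f = g(Ax + b)` with
`(A, b) ∈ GLaff_n(F)`, and any `(t+1)`-independent polynomial map `G`, `f ∘ G ≠ 0` — over EVERY
field. Printed proof (§6.1) by induction on `t` via Lemmas 3.8–3.10; the characteristic-`p` gap of
Case 1 ("`∂g/∂x_i` is non-zero") is closed here by choosing a variable with an exponent nonzero in
`F`, and otherwise by the Frobenius twist (all exponents divisible by `p`), see
`MS2021.bind₁_affSubst_ne_zero_of_card_support_le`.
[cite: MediniShpilka2021, Thm 43 (CCC p.19:14; = arXiv unnumbered ‹PITSINV› p0009:L1-L2) and its proof §6.1 (arXiv p0034:L31-p0035:L3)] -/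
theorem MS2021_thm_43_holds : MS2021_thm_43 := by
  intro K _ n m t c g hg hs f hf G hG
  obtain ⟨h, A, b, hA, rfl⟩ := hf
  exact bind₁_affSubst_ne_zero_of_card_support_le t g.totalDegree m g hg hs le_rfl h A b hA c G hG

end Thm43

end Literature.Computability.AlgebraicComplexity

end
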